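import Summits.ABC.IUTFork.Joshi.TestThetaValuesLocusModel
import Summits.ABC.IUTFork.Joshi.LogLinkFrobeniusTransport
import HarnessLib

/-!
# A kernel MODEL of the [J-IIp] §10 log-link column with a NON-TRIVIAL Frobenius: the (R-ϕ) horn of Thm. 10.15.1 (3)/(4) and a
# non-degenerate `KummerShift` are instantiated together with the whole period-ring signature — VACUITY CHECK, nothing more

Test-side support file of the abc-iut cell, branch E «type Joshi's construction, test vs S» (rung LADDER-ABC:A2.E; seat abc-iut-E-t52,
[J-IIp] lane; self-directed sequel announced on HOME/STATUS.md 2026-08-26T08:4xZ). Source of the hypotheses instantiated here: K. Joshi,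
arXiv:2303.01662v3 §10 (bib `Joshi2023ATS2Local`, unrefereed — TYPED AS A CANDIDATE by seats abc-iut-E-t3 / E-t7 / E-t2 in
`Joshi/LogLinkColumn.lean` p429867, `Joshi/LogLinkFrobeniusTransport.lean` p430819, `Joshi/LogLinkTeichmullerLifts.lean` p431042,
`Joshi/TestATS2LogKummer.lean` p430740). TAKES NO SIDE on [IUTchIII] Cor. 3.12, on Joshi's claims, or on Mochizuki's reports on them; a
model EXHIBITS joint satisfiability of TYPED hypotheses, nothing more; typed ≠ proved ≠ endorsed.

WHY. In abc-iut-E-t3's vacuity model `Model.periodRingDatum p` (`Joshi/TestThetaValuesLocusModel.lean`: `B := (Q̄_p → Q̄_p)`, `η_y` =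
evaluation, `φ := id` on `B`, `T_y := {0}`) the Frobenius eigenspace `B^{φ=p} = {b | φ b = p·b}` is `{0}`, so the §10 hypotheses —
E-t3's `KummerShift` (`T_y ⊆ B^{φ=p}`, `φ(T_y) ⊆ T_{φ(y)}`), E-t7's `FrobeniusTransport y` (φ a ring map with `ker(η_{φ(y)} ∘ φ) = ker η_y`,
§10.13 «`ϕ(𝔪_{y_{n−1}}) = 𝔪_{y_n}`»), and the side condition «`∃ b ∈ B^{φ=p}, η_{φ(y)}(b) = 1`» of the fork theorems — hold there only
DEGENERATELY or not at all. This file supplies ONE model of the full `PeriodRingDatum` signature in which they hold NON-degenerately, so that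
the located (R-ϕ) horn of p430819 — «under the Frobenius-transported identifications, Thm. 10.15.1 (3) FAILS (`τ = id` commutes) while (4)
`log(shell_{n−1}) ⊆ p·log(shell_n)` HOLDS» — is a statement about a NONEMPTY class of structures (refuters' vacuity smell, CONVENTIONS §4).

THE MODEL `columnDatum p` = E-t3's `Model.periodRingDatum p` with exactly two fields changed: (i) `φ(b) := b ∘ σ`, where `σ` shifts a
two-sided FROBENIUS COLUMN `c : ℤ → Q̄_p`, `c_{n+1} = c_n^p` (forward: powers of `c_0 := p^{p+1}`; backward: chosen `p`-th roots, `Q̄_p`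
algebraically closed), `σ(c_n) = c_{n−1}`, and fixes every point off the column (the base point `p` of E-t3's norm is off the column, so
`B⁺`-stability and `|[x]|_ρ = |x|_F` survive); (ii) `T_y := {τ ∈ B^{φ=p} | τ vanishes on the forward φ-orbit y, y^p, y^{p²}, …}`. Then
`B^{φ=p}` contains the non-zero functions `b(c_n) = p^{m−n}`, `b = 0` off the column (`colGen m`); `KummerShift` HOLDS (`kummerShift`) and
`T_{y_p} ∋ colGen 0 ≠ 0` at the Ansatz base point `y_p = p` (`tateModule_nontrivial`; on the column itself `T` is `{0}` — one orbit carries a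
one-dimensional eigenspace); at EVERY column point `c_n`: `FrobeniusTransport` (`transport n`), a `CommonTarget` with identity
identifications which is `FrobCompatible` (`frobCompatible n`), and `colGen (n+1) ∈ B^{φ=p}` with `η_{φ(c_n)}(colGen (n+1)) = 1` (`hone n`).
CONSEQUENCES IN THE MODEL (by the landed implications, cited BY NAME): `¬ NoInsertedIso` (Thm. 10.15.1 (3) in common-target form FAILS),
`¬ NoCommutingFieldIso (c_n)` (E-t3's as-printed middle-row typing fails), `LogShellStep` ((4) holds), and `¬ LogsCoincide` (the (R-fix)
reading is refuted HERE — every pull-back model transports; the (R-fix) horn's own non-vacuity is NOT addressed by this file).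
Packaged: `rphi_horn_nonvacuous` (over `Q̄_2`). [folklore] model-building; no claim about Joshi's or Mochizuki's mathematics.
-/

noncomputable section

open Set

namespace Summit.ABC.IUTFork.Joshi.ColumnModel

open PadicAlgCl Summit.ABC.IUTFork.Joshi.Model

variable (p : ℕ) [hp : Fact p.Prime]

/-! ## 0. Small `p`-adic facts (private local copies, as in E-t3's model files; the tree's Literature versions live in modules this file does not import) -/

/-- `‖p‖ = p⁻¹` in `Q̄_p`. [folklore] -/
private theorem norm_natCast_p : ‖(p : PadicAlgCl p)‖ = (p : ℝ)⁻¹ := by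
  rw [← map_natCast (algebraMap ℚ_[p] (PadicAlgCl p)), ← PadicAlgCl.coe_eq]
  show ‖((p : ℚ_[p]) : PadicAlgCl p)‖ = _
  rw [PadicAlgCl.norm_extends, Padic.norm_p]

/-- `1 < p` in `ℝ`. [folklore] -/
private theorem one_lt_p_real : (1 : ℝ) < (p : ℝ) := by exact_mod_cast hp.out.one_lt

/-- `0 < ‖p‖ < 1` in `Q̄_p`. [folklore] -/
private theorem norm_p_pos_lt_one : 0 < ‖(p : PadicAlgCl p)‖ ∧ ‖(p : PadicAlgCl p)‖ < 1 := by
  rw [norm_natCast_p]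
  exact ⟨inv_pos.2 (lt_trans one_pos (one_lt_p_real p)), inv_lt_one_of_one_lt₀ (one_lt_p_real p)⟩

/-- `(p : Q̄_p) ≠ 0`. [folklore] -/
private theorem natCast_p_ne_zero : (p : PadicAlgCl p) ≠ 0 := fun h => by
  have := (norm_p_pos_lt_one p).1; rw [h, norm_zero] at this; exact lt_irrefl _ this

/-- `(p : Q̄_p) ≠ 1`. [folklore] -/
private theorem natCast_p_ne_one : (p : PadicAlgCl p) ≠ 1 := fun h => by
  have := (norm_p_pos_lt_one p).2; rw [h, norm_one] at this; exact lt_irrefl _ this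

/-- Exponent injectivity for a base in `(0,1)`: `b^x = b^y ⇒ x = y`. [folklore] -/
private theorem rpow_exp_injective {b x y : ℝ} (hb0 : 0 < b) (hb1 : b < 1) (h : b ^ x = b ^ y) : x = y :=
  le_antisymm ((Real.rpow_le_rpow_left_iff_of_base_lt_one hb0 hb1).1 h.ge)
    ((Real.rpow_le_rpow_left_iff_of_base_lt_one hb0 hb1).1 h.le)

/-- The arithmetic heart of «the base point and its Frobenius orbit are OFF the column»: `p^m ≠ (p+1)·p^n` for `m ∈ ℕ`, `n ∈ ℤ`
(`p ∤ p + 1`). [folklore] -/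
theorem pow_ne_succ_mul_zpow (m : ℕ) (n : ℤ) : ((p : ℝ) ^ m : ℝ) ≠ ((p : ℝ) + 1) * (p : ℝ) ^ n := by
  intro h
  have hp0 : (p : ℝ) ≠ 0 := by exact_mod_cast hp.out.ne_zero
  have hk : (p : ℝ) ^ ((m : ℤ) - n) = p + 1 := by
    rw [zpow_sub₀ hp0, zpow_natCast, h, mul_div_assoc, div_self (zpow_ne_zero n hp0), mul_one]
  rcases le_or_gt ((m : ℤ) - n) 0 with hle | hgt
  · have h1 : (p : ℝ) ^ ((m : ℤ) - n) ≤ 1 := zpow_le_one_of_nonpos₀ (one_lt_p_real p).le hle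
    have h2 : (0 : ℝ) < p := lt_trans one_pos (one_lt_p_real p)
    linarith
  · obtain ⟨j, hj⟩ := Int.eq_ofNat_of_zero_le hgt.le
    rw [hj, zpow_natCast] at hk
    have hj1 : j ≠ 0 := by rintro rfl; simp at hj; omega
    have hnat : p ^ j = p + 1 := by exact_mod_cast hk
    have hdvd : p ∣ p + 1 := hnat ▸ dvd_pow_self p hj1
    have h1 : p ∣ 1 := (Nat.dvd_add_right (dvd_refl p)).1 hdvd
    exact hp.out.one_lt.ne' (Nat.dvd_one.1 h1)

/-! ## 1. A two-sided Frobenius column in `Q̄_p` -/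

/-- A chosen `p`-th root (`Q̄_p` is algebraically closed). [folklore] -/
def pthRoot (x : PadicAlgCl p) : PadicAlgCl p := (IsAlgClosed.exists_pow_nat_eq x hp.out.pos).choose

/-- `(pthRoot x)^p = x`. [folklore] -/
theorem pthRoot_pow (x : PadicAlgCl p) : pthRoot p x ^ p = x := (IsAlgClosed.exists_pow_nat_eq x hp.out.pos).choose_spec

/-- The base point of the column, `c_0 := p^{p+1}` (chosen so that `p` and its Frobenius orbit `p^{p^m}` avoid the column). [folklore] -/
def colBase : PadicAlgCl p := (p : PadicAlgCl p) ^ (p + 1)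

/-- `‖c_0‖ = ‖p‖^{p+1}`. [folklore] -/
theorem norm_colBase : ‖colBase p‖ = ‖(p : PadicAlgCl p)‖ ^ ((p : ℝ) + 1) := by
  rw [colBase, norm_pow, ← Real.rpow_natCast]; push_cast; rfl

/-- `0 < ‖c_0‖ < 1`. [folklore] -/
theorem norm_colBase_pos_lt_one : 0 < ‖colBase p‖ ∧ ‖colBase p‖ < 1 := by
  rw [colBase, norm_pow]
  exact ⟨pow_pos (norm_p_pos_lt_one p).1 _, pow_lt_one₀ (norm_nonneg _) (norm_p_pos_lt_one p).2 (by omega)⟩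

/-- Backward iterates: `c_0, c_0^{1/p}, c_0^{1/p²}, …` (chosen roots). [folklore] -/
def colBack : ℕ → PadicAlgCl p
  | 0 => colBase p
  | k + 1 => pthRoot p (colBack k)

/-- **The two-sided Frobenius column** `c : ℤ → Q̄_p`: `c_n = c_0^{p^n}` for `n ≥ 0`, `c_{−k} =` the `k`-th chosen root. [folklore] -/
def col : ℤ → PadicAlgCl p
  | Int.ofNat k => colBase p ^ p ^ k
  | Int.negSucc k => colBack p (k + 1)

/-- `c_0 = p^{p+1}`. [folklore] -/
theorem col_zero : col p 0 = colBase p := by show colBase p ^ p ^ 0 = colBase p; rw [pow_zero, pow_one]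

/-- **The column is a Frobenius orbit**: `c_{n+1} = c_n^p` for every `n ∈ ℤ`. [folklore] -/
theorem col_succ (n : ℤ) : col p (n + 1) = col p n ^ p := by
  rcases n with k | k
  · show col p (Int.ofNat (k + 1)) = (colBase p ^ p ^ k) ^ p
    show colBase p ^ p ^ (k + 1) = _
    rw [pow_succ, pow_mul]
  · rcases k with _ | k
    · show col p 0 = (pthRoot p (colBase p)) ^ p
      rw [col_zero, pthRoot_pow]
    · show colBack p (k + 1) = (pthRoot p (colBack p (k + 1))) ^ p
      rw [pthRoot_pow]

/-- `c_n = c_{n−1}^p`. [folklore] -/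
theorem col_eq_pow_pred (n : ℤ) : col p n = col p (n - 1) ^ p := by
  rw [← col_succ, sub_add_cancel]

/-- **Norms along the column**: `‖c_n‖ = ‖c_0‖^{p^n}` (so `|p|`-valuations scale by `p` at each step, [J-IIp] Thm. 10.20.1 (3) in the model).
[folklore] -/
theorem norm_col (n : ℤ) : ‖col p n‖ = ‖colBase p‖ ^ ((p : ℝ) ^ n) := by
  have hp0 : (p : ℝ) ≠ 0 := by exact_mod_cast hp.out.ne_zero
  induction n using Int.induction_on with
  | zero => rw [col_zero, zpow_zero, Real.rpow_one]
  | succ n ih =>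
    rw [col_succ, norm_pow, ih, ← Real.rpow_natCast, ← Real.rpow_mul (norm_nonneg _), zpow_add_one₀ hp0]
  | pred n ih =>
    have h : ‖col p (-(n : ℤ) - 1)‖ ^ p = ‖col p (-(n : ℤ))‖ := by rw [← norm_pow, ← col_eq_pow_pred]
    have h' : ‖col p (-(n : ℤ) - 1)‖ = ‖col p (-(n : ℤ))‖ ^ ((p : ℝ)⁻¹) := by
      rw [← h, Real.pow_rpow_inv_natCast (norm_nonneg _) hp.out.ne_zero]
    rw [h', ih, ← Real.rpow_mul (norm_nonneg _), zpow_sub_one₀ hp0]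

/-- The column is injective (its norms are pairwise distinct). [folklore] -/
theorem col_injective : Function.Injective (col p) := by
  intro n m h
  have hn := congrArg (‖·‖) h
  simp only [norm_col] at hn
  have he : (p : ℝ) ^ n = (p : ℝ) ^ m := rpow_exp_injective (norm_colBase_pos_lt_one p).1 (norm_colBase_pos_lt_one p).2 hn
  exact zpow_right_injective₀ (lt_trans one_pos (one_lt_p_real p)) (one_lt_p_real p).ne' he

/-- **The base point's Frobenius orbit avoids the column**: `p^{p^m} ≠ c_n` (norms `‖p‖^{p^m}` vs `‖p‖^{(p+1)p^n}`). [folklore] -/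
theorem pow_p_ne_col (m : ℕ) (n : ℤ) : (p : PadicAlgCl p) ^ p ^ m ≠ col p n := by
  intro h
  have hn := congrArg (‖·‖) h
  simp only [norm_pow, norm_col, norm_colBase] at hn
  rw [← Real.rpow_natCast, ← Real.rpow_mul (norm_nonneg _)] at hn
  have he := rpow_exp_injective (norm_p_pos_lt_one p).1 (norm_p_pos_lt_one p).2 hn
  exact pow_ne_succ_mul_zpow p m n (by push_cast at he; exact he)

/-- In particular `p` itself is off the column. [folklore] -/
theorem p_ne_col (n : ℤ) : (p : PadicAlgCl p) ≠ col p n := by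
  have := pow_p_ne_col p 0 n; rwa [pow_zero, pow_one] at this

/-! ## 2. The shift `σ` and the Frobenius eigenfunctions -/

open Classical in
/-- **The shift** `σ`: `σ(c_n) = c_{n−1}` on the column, identity elsewhere. [folklore] -/
def shift (s : PadicAlgCl p) : PadicAlgCl p := if h : ∃ n : ℤ, col p n = s then col p (h.choose - 1) else s

/-- `σ(c_n) = c_{n−1}`. [folklore] -/
theorem shift_col (n : ℤ) : shift p (col p n) = col p (n - 1) := by
  have h : ∃ m : ℤ, col p m = col p n := ⟨n, rfl⟩
  unfold shift; rw [dif_pos h, col_injective p h.choose_spec]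

/-- `σ` fixes every point off the column. [folklore] -/
theorem shift_of_not_col {s : PadicAlgCl p} (hs : ∀ n : ℤ, col p n ≠ s) : shift p s = s := by
  unfold shift; rw [dif_neg (not_exists.2 hs)]

/-- `σ(p) = p`. [folklore] -/
theorem shift_p : shift p (p : PadicAlgCl p) = p := shift_of_not_col p fun n h => p_ne_col p n h.symm

/-- `σ(c_n^p) = c_n` — the identity behind §10.13's «`ϕ(𝔪_{y}) = 𝔪_{ϕ(y)}`» in the model. [folklore] -/
theorem shift_col_pow (n : ℤ) : shift p (col p n ^ p) = col p n := by
  rw [← col_succ, shift_col, add_sub_cancel_right]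

open Classical in
/-- **The eigenfunctions** `colGen m`: `p^{m−n}` at `c_n`, `0` off the column. [folklore] -/
def colGen (m : ℤ) (s : PadicAlgCl p) : PadicAlgCl p :=
  if h : ∃ n : ℤ, col p n = s then (p : PadicAlgCl p) ^ (m - h.choose) else 0

/-- `colGen m (c_n) = p^{m−n}`. [folklore] -/
theorem colGen_col (m n : ℤ) : colGen p m (col p n) = (p : PadicAlgCl p) ^ (m - n) := by
  have h : ∃ k : ℤ, col p k = col p n := ⟨n, rfl⟩
  unfold colGen; rw [dif_pos h, col_injective p h.choose_spec]

/-- `colGen m = 0` off the column. [folklore] -/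
theorem colGen_of_not_col (m : ℤ) {s : PadicAlgCl p} (hs : ∀ n : ℤ, col p n ≠ s) : colGen p m s = 0 := by
  unfold colGen; rw [dif_neg (not_exists.2 hs)]

/-- `colGen m (c_m) = 1` (the normalisation used for «`η(b) = 1`»). [folklore] -/
theorem colGen_self (m : ℤ) : colGen p m (col p m) = 1 := by rw [colGen_col, sub_self, zpow_zero]

/-- `colGen m ≠ 0`. [folklore] -/
theorem colGen_ne_zero (m : ℤ) : colGen p m ≠ 0 := fun h => by
  have := congrFun h (col p m); rw [colGen_self] at this; exact one_ne_zero this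

/-- **The eigen-relation** `colGen m (σ s) = p · colGen m (s)` for every `s`. [folklore] -/
theorem colGen_shift (m : ℤ) (s : PadicAlgCl p) : colGen p m (shift p s) = (p : PadicAlgCl p) * colGen p m s := by
  by_cases h : ∃ n : ℤ, col p n = s
  · obtain ⟨n, rfl⟩ := h
    rw [shift_col, colGen_col, colGen_col, show m - (n - 1) = (m - n) + 1 by ring,
      zpow_add_one₀ (natCast_p_ne_zero p), mul_comm]
  · have hs : ∀ n : ℤ, col p n ≠ s := not_exists.1 h
    rw [shift_of_not_col p hs, colGen_of_not_col p m hs, mul_zero]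

/-! ## 3. The model datum -/

/-- **The column model** of the period-ring signature: E-t3's `Model.periodRingDatum p` with `φ(b) := b ∘ σ` and
`T_y := {τ | τ ∘ σ = p·τ pointwise ∧ τ vanishes on y, y^p, y^{p²}, …}`; every other field (norms, Teichmüller/untilt map, residue
valuations, points, Galois data) is E-t3's, unchanged. [folklore] -/
def columnDatum : PeriodRingDatum (PadicAlgCl p) (PadicAlgCl p → PadicAlgCl p) (PadicAlgCl p) (PadicAlgCl p)
    (fun _ => PadicAlgCl p) Unit :=
  { Model.periodRingDatum p with
    frob := fun b => b ∘ shift p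
    frob_norm_one := fun b hb => by
      show ‖(b ∘ shift p) (p : PadicAlgCl p)‖ ≤ 1
      rw [Function.comp_apply, shift_p]; exact hb
    T := fun y => {τ | (∀ s, τ (shift p s) = (p : PadicAlgCl p) * τ s) ∧ ∀ m : ℕ, τ (y ^ p ^ m) = 0}
    zero_mem_T := fun y => ⟨fun s => by simp, fun m => rfl⟩
    eta_T := fun y τ hτ => by
      show τ y = 0
      have := hτ.2 0; rwa [pow_zero, pow_one] at this
    T_norm_one := fun y τ hτ => by
      show ‖τ (p : PadicAlgCl p)‖ ≤ 1
      have h := hτ.1 (p : PadicAlgCl p)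
      rw [shift_p] at h
      have h0 : τ (p : PadicAlgCl p) = 0 :=
        ((mul_left_eq_self₀.1 h.symm).resolve_left (natCast_p_ne_one p))
      rw [h0, norm_zero]; exact zero_le_one }

/-- Unfolding: `φ(b) = b ∘ σ`. [folklore] -/
theorem frob_def (b : PadicAlgCl p → PadicAlgCl p) : (columnDatum p).frob b = b ∘ shift p := rfl

/-- Unfolding: `η_y(b) = b(y)`. [folklore] -/
theorem eta_def (y : PadicAlgCl p) (b : PadicAlgCl p → PadicAlgCl p) : (columnDatum p).eta y b = b y := rfl

/-- Unfolding: `φ(y) = y^p` on points. [folklore] -/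
theorem frobY_def (y : PadicAlgCl p) : (columnDatum p).frobY y = y ^ p := rfl

/-- Unfolding: the model's `p` is `p`. [folklore] -/
theorem p_def : (columnDatum p).p = p := rfl

/-- **Membership in `B^{φ=p}`** is the pointwise eigen-relation `b(σ s) = p·b(s)`. [folklore] -/
theorem mem_Bphi_iff (b : PadicAlgCl p → PadicAlgCl p) :
    b ∈ (columnDatum p).Bphi ↔ ∀ s, b (shift p s) = (p : PadicAlgCl p) * b s := by
  show (b ∘ shift p = ((p : ℕ) : PadicAlgCl p → PadicAlgCl p) * b) ↔ _
  constructor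
  · intro h s; have := congrFun h s; simpa using this
  · intro h; funext s; simpa using h s

/-- `colGen m ∈ B^{φ=p}` — the eigenspace is NON-ZERO in this model. [folklore] -/
theorem colGen_mem_Bphi (m : ℤ) : colGen p m ∈ (columnDatum p).Bphi := (mem_Bphi_iff p _).2 (colGen_shift p m)

/-- `B^{φ=p} ≠ {0}`. [folklore] -/
theorem bphi_nontrivial : ∃ b ∈ (columnDatum p).Bphi, b ≠ 0 := ⟨colGen p 0, colGen_mem_Bphi p 0, colGen_ne_zero p 0⟩

/-- Eigenfunctions vanish off the column (`b(s) = p·b(s)` there). [folklore] -/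
theorem eq_zero_of_mem_Bphi {b : PadicAlgCl p → PadicAlgCl p} (hb : b ∈ (columnDatum p).Bphi) {s : PadicAlgCl p}
    (hs : ∀ n : ℤ, col p n ≠ s) : b s = 0 := by
  have h := (mem_Bphi_iff p b).1 hb s
  rw [shift_of_not_col p hs] at h
  exact (mul_left_eq_self₀.1 h.symm).resolve_left (natCast_p_ne_one p)

/-- Membership in `T_y`, unfolded. [folklore] -/
theorem mem_T_iff (y : PadicAlgCl p) (τ : PadicAlgCl p → PadicAlgCl p) :
    τ ∈ (columnDatum p).T y ↔ τ ∈ (columnDatum p).Bphi ∧ ∀ m : ℕ, τ (y ^ p ^ m) = 0 := by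
  rw [mem_Bphi_iff]; rfl

/-! ## 4. `KummerShift` holds, non-degenerately -/

/-- **E-t3's `KummerShift` ([J-IIp] Thm. 10.20.1 (1)(2) reading: `T_y ⊆ B^{φ=p}` and `φ(T_y) ⊆ T_{φ(y)}`) HOLDS in the column model.**
(The second clause: `φ τ = τ ∘ σ` is again an eigenfunction, and at `s = (y^p)^{p^m} = y^{p^{m+1}}` one has
`τ(σ s) = p·τ(s) = p·0`.) [folklore] -/
theorem kummerShift : (columnDatum p).KummerShift := by
  refine ⟨fun y τ hτ => ((mem_T_iff p y τ).1 hτ).1, fun y τ hτ => ?_⟩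
  obtain ⟨h1, h2⟩ := (mem_T_iff p y τ).1 hτ
  rw [mem_Bphi_iff] at h1
  refine (mem_T_iff p _ _).2 ⟨(mem_Bphi_iff p _).2 fun s => ?_, fun m => ?_⟩
  · show τ (shift p (shift p s)) = (p : PadicAlgCl p) * τ (shift p s)
    exact h1 (shift p s)
  · show τ (shift p (((columnDatum p).frobY y) ^ p ^ m)) = 0
    rw [frobY_def, ← pow_mul, ← pow_succ', h1, h2 (m + 1), mul_zero]

/-- **`T` is non-degenerate**: at the Ansatz base point `y_p = p` (E-t3's `pt = id`, `0 < ‖p‖ < 1`) the Tate module contains the non-zero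
eigenfunction `colGen 0` (it vanishes on the orbit `p, p^p, p^{p²}, …`, which avoids the column). [folklore] -/
theorem colGen_mem_T_p : colGen p 0 ∈ (columnDatum p).T (p : PadicAlgCl p) :=
  (mem_T_iff p _ _).2 ⟨colGen_mem_Bphi p 0, fun m => colGen_of_not_col p 0 fun n h => pow_p_ne_col p m n h.symm⟩

/-- `T_{y_p} ≠ {0}`. [folklore] -/
theorem tateModule_nontrivial : ∃ τ ∈ (columnDatum p).T (p : PadicAlgCl p), τ ≠ 0 :=
  ⟨colGen p 0, colGen_mem_T_p p, colGen_ne_zero p 0⟩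

/-! ## 5. §10.13's Frobenius transport at every column point, the common target, (R-ϕ) -/

/-- **E-t7's `FrobeniusTransport` at the column point `c_n`** (§10.13): `φ` is the ring map `b ↦ b ∘ σ`, both evaluations are onto, and
`ker(η_{c_n^p} ∘ φ) = ker η_{c_n}` because `σ(c_n^p) = c_n`. [folklore] -/
def transport (n : ℤ) : (columnDatum p).FrobeniusTransport (col p n) where
  frobHom := RingHom.pi fun s => Pi.evalRingHom (fun _ : PadicAlgCl p => PadicAlgCl p) (shift p s)
  frobHom_eq _ := rfl
  eta_surj k := ⟨fun _ => k, rfl⟩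
  eta_frob_surj k := ⟨fun _ => k, rfl⟩
  ker_eq := by
    ext b
    simp only [RingHom.mem_ker, RingHom.coe_comp, Function.comp_apply]
    show b (shift p (col p n ^ p)) = 0 ↔ b (col p n) = 0
    rw [shift_col_pow]

/-- **E-t7's `CommonTarget` at `c_n`** with `C := Q̄_p` and the IDENTITY identifications `K_{c_n} = K_{c_n^p} = Q̄_p` (§10.14 «natural
identification `K_{y_n} ≃ ℂ_p`», here literal equality of carriers). [folklore] -/
def target (n : ℤ) : (columnDatum p).CommonTarget (PadicAlgCl p) (col p n) where
  iso₀ := RingEquiv.refl _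
  iso₁ := RingEquiv.refl _

/-- **Reading (R-ϕ) HOLDS in the model**: the Frobenius-induced residue isomorphism `σ_y` IS the identity of `Q̄_p` through the identity
identifications (`σ_y(η_y b) = η_{y^p}(φ b) = b(σ(c_n^p)) = b(c_n) = η_y b`). [folklore] -/
theorem frobCompatible (n : ℤ) : PeriodRingDatum.FrobCompatible (transport p n) (target p n) := by
  intro k
  obtain ⟨b, rfl⟩ : ∃ b : PadicAlgCl p → PadicAlgCl p, (columnDatum p).eta (col p n) b = k := ⟨fun _ => k, rfl⟩
  show (transport p n).residueIso ((columnDatum p).eta (col p n) b) = (columnDatum p).eta (col p n) b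
  rw [(transport p n).residueIso_eta, eta_def, eta_def, frobY_def, frob_def, Function.comp_apply, shift_col_pow]

/-- **«The logarithm hits `1`»** at every column step: `colGen (n+1) ∈ B^{φ=p}` and `η_{φ(c_n)}(colGen (n+1)) = colGen (n+1) (c_{n+1}) = 1`.
[folklore] -/
theorem hone (n : ℤ) : ∃ b ∈ (columnDatum p).Bphi, (columnDatum p).eta ((columnDatum p).frobY (col p n)) b = 1 :=
  ⟨colGen p (n + 1), colGen_mem_Bphi p _, by rw [eta_def, frobY_def, ← col_succ, colGen_self]⟩

/-- `p ≠ 1` in the common target. [folklore] -/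
theorem modelP_ne_one : ((columnDatum p).p : PadicAlgCl p) ≠ 1 := by rw [p_def]; exact natCast_p_ne_one p

/-! ## 6. Consequences: the (R-ϕ) horn of [J-IIp] Thm. 10.15.1, non-vacuously -/

/-- **Thm. 10.15.1 (3) in common-target form FAILS in the model** (E-t7's `not_noInsertedIso_of_frobCompatible`, p430819): the identity
of `Q̄_p` makes every square commute. [folklore] -/
theorem not_noInsertedIso (n : ℤ) : ¬ PeriodRingDatum.NoInsertedIso (target p n) :=
  PeriodRingDatum.not_noInsertedIso_of_frobCompatible (transport p n) (target p n) (frobCompatible p n)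

/-- **E-t3's as-printed middle-row typing `NoCommutingFieldIso` FAILS at every column point** (E-t7's
`not_noCommutingFieldIso_of_transport`). [folklore] -/
theorem not_noCommutingFieldIso (n : ℤ) : ¬ (columnDatum p).NoCommutingFieldIso (col p n) :=
  (columnDatum p).not_noCommutingFieldIso_of_transport (transport p n)

/-- **Thm. 10.15.1 (4) HOLDS in the model** (`log(shell_{n−1}) ⊆ p·log(shell_n)`; E-t7's `logShellStep_of_frobCompatible`). [folklore] -/
theorem logShellStep (n : ℤ) : PeriodRingDatum.LogShellStep (target p n) :=
  PeriodRingDatum.logShellStep_of_frobCompatible (transport p n) (target p n) (frobCompatible p n)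

/-- **The (R-fix) reading is REFUTED here** (E-t7's `logsCoincide_frobCompatible_absurd`): a pull-back model transports, so the two
logarithms differ by `p` on `B^{φ=p}` and cannot coincide. (The (R-fix) horn's own non-vacuity is not addressed by this file.) [folklore] -/
theorem not_logsCoincide (n : ℤ) : ¬ PeriodRingDatum.LogsCoincide (target p n) := fun h =>
  PeriodRingDatum.logsCoincide_frobCompatible_absurd (transport p n) (target p n) (frobCompatible p n) h (hone p n)
    (modelP_ne_one p)

/-- **NON-VACUITY OF THE (R-ϕ) HORN, packaged** (over `Q̄_2`): ONE structure satisfying the whole period-ring signature in which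
`KummerShift` holds with a non-zero Tate module, §10.13's Frobenius transport and the Frobenius-compatible common target exist at a point,
the logarithm hits `1`, `p ≠ 1` — and consequently Thm. 10.15.1 (3) (common-target form) and the middle-row typing FAIL while (4) HOLDS.
A model exhibits satisfiability, nothing more. [folklore] -/
theorem rphi_horn_nonvacuous :
    ∃ (D : PeriodRingDatum (PadicAlgCl 2) (PadicAlgCl 2 → PadicAlgCl 2) (PadicAlgCl 2) (PadicAlgCl 2) (fun _ => PadicAlgCl 2) Unit)
      (y : PadicAlgCl 2) (T : D.FrobeniusTransport y) (I : D.CommonTarget (PadicAlgCl 2) y),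
      D.KummerShift ∧ (∃ y' τ, τ ∈ D.T y' ∧ τ ≠ 0) ∧ PeriodRingDatum.FrobCompatible T I ∧
        (∃ b ∈ D.Bphi, D.eta (D.frobY y) b = 1) ∧ (D.p : PadicAlgCl 2) ≠ 1 ∧
        ¬ PeriodRingDatum.NoInsertedIso I ∧ ¬ D.NoCommutingFieldIso y ∧ PeriodRingDatum.LogShellStep I :=
  haveI : Fact (Nat.Prime 2) := ⟨Nat.prime_two⟩
  ⟨columnDatum 2, col 2 0, transport 2 0, target 2 0, kummerShift 2,
    (let ⟨τ, hτ, hτ0⟩ := tateModule_nontrivial 2; ⟨(2 : PadicAlgCl 2), τ, hτ, hτ0⟩), frobCompatible 2 0, hone 2 0,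
    modelP_ne_one 2, not_noInsertedIso 2 0, not_noCommutingFieldIso 2 0, logShellStep 2 0⟩

end Summit.ABC.IUTFork.Joshi.ColumnModel

end
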